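import Mathlib
import HarnessLib
import Summits.QuantumFields.YangMills.Theses.GronwallGap
import Summits.QuantumFields.YangMills.Theorems.GronwallGapPathGapModulusLocalTrichotomy

/-!
# Line `birth` — skeleton for the crux `PathGapModulus` (stmt-QuantumFields-13946), cycle 7 (lead c6): the local trichotomy, compositions in the tree, Dobrushin region verified

Route `GronwallGap` (route-QuantumFields-GronwallGap) of the sub-problem `YangMills`; crux rank 2, concluded BY NAME
below: `Summit.QuantumFields.YangMills.Theses.GronwallGap.PathGapModulus` — along an ADMISSIBLE reflection-positive
single-plaquette weight path `w : [0,1] → (G → ℝ)` whose torus pressure is Gateaux-analytic at every parameter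
(`Adm w`, `∀ s, AnP (w s)`), the volume-uniform clustering predicate `UCw w s m` is transported with the capped
modulus `UCw w s m → UCw w s' m'` for every `0 < m' < min m M · e^(−K|s'−s|)`.

## History of the line

* birth (planner, 2026-08-17): stubs `stub_aprioriStability` + `stub_sumRuleLipschitz`, discrete-Gronwall composition.
* cycle 1 (lead 0): `stub_sumRuleLipschitz` discharged by logic (p147555; the rev-4 rate cap makes the log-Lipschitz
  modulus vacuous); `stub_aprioriStability` certified EQUIVALENT to the crux and to **NoGapCollapse**
  `Adm w → (∀ s, AnP (w s)) → (∃ s₀ m₀ > 0, UCw w s₀ m₀) → ∃ μ > 0, ∀ s ∈ [0,1], UCw w s μ` (p150915).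
* cycle 2 (lead c1): `stub_localFloor` + `stub_closedUnderAnalyticPressure`; composition landed p150915.
* cycle 3 (lead c2): the LOSSLESS trichotomy S1 `stub_clusteringOpen` / S2 `stub_uniformRate` / S3 `stub_closedAtCommonRate`;
  composition + `pathGapModulus_iff_trichotomy` landed p153964; near-Haar region landed p155815 (all stubs hold on the
  strong-coupling polydisc `sup|log w s| ≤ betaR/4`); all three stub-blocked off the polydisc (memos `MEMO-c3-*.md`).
* cycle 4 (lead c3): S2 LOCALISED to S2loc `stub_localRateFloor`; S3 re-cut into S3u `stub_closedOfUniformConstants`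
  (LANDED p157765, finite-volume continuity) + E `stub_onePointContinuous` (LANDED p159088: `AnP` ⇒ continuous
  class-function one-point functions — the complete correlation content of the certificate) + S3b
  `stub_uniformConstantsAtCommonRate` (the open physics core); `crux ⇔ S1 ∧ S2loc ∧ S3b` proved inside the skeleton.
* cycle 5 (lead c4): the cycle-4 compositions are now IN THE TREE, sorry-free —
  `Theorems/GronwallGapPathGapModulusLocalTrichotomy.lean` (p161847): `pathGap_uniformRate_of_localRateFloor` (compactness),
  `pathGap_uniformRate_of_localRateFloor'` (S2loc ⇒ S2), `pathGap_closedAtRate_of_uniformConstantsAtCommonRate` (S3b ⇒ S3,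
  discharging S3u and E), `pathGapModulus_of_localTrichotomy` (S1 → S2loc → S3b → crux) and
  `pathGapModulus_iff_localTrichotomy : PathGapModulus ↔ (S1 ∧ S2loc ∧ S3b)`. The skeleton is therefore reduced to the
  three open LOCAL stubs and one line of glue: promoting S1/S2loc/S3b to items closes the crux mechanically from the tree.
  Independent re-audit of the definitions (lead c4): no loophole — `groupHeatKernelMeasure` is normalised,
  `IsCompactSimpleLieGroup` = connected + non-abelian + simple + linear, `YMSpecies` non-degenerate, `UCw` tests shifts
  `n ≤ S` on the torus of side `2S+1`; the crux is verbatim the lattice conjecture "along RP single-plaquette paths the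
  gap closes only at bulk pressure singularities". Literature frontier re-read: arXiv:2606.19362 (Fortschr. Phys. 2026,
  claimed RP construction of 4d SU(N) YM with gap) controls the transfer-matrix gap only in the COARSE direction
  (its Lemma 5.2: `λ₂(T_(k+1)) ≤ λ₂(T_k)^b + ε_k`, presupposing the fine-scale gap) — nothing usable for S1/S2loc/S3b.

* cycle 6 (lead c5): skeleton UNCHANGED in its stubs (re-registered 13:58Z, full signatures re-added); landed around the line:
  `Theorems/GronwallGapPathGapModulusHypothesisWitness.lean` (p165177, `pathGap_hypothesisClass_inhabited`: for every compact
  simple `G` the hypothesis class `Adm w ∧ ∀ s, AnP (w s)` is inhabited WITH a clustering parameter `UCw w 0 m₀` — the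
  strong-coupling Wilson window path; the crux is certified non-vacuous) and `Theorems/GronwallGapPathGapModulusCertificateReading.lean`
  (`pathGap_anP_iff_analyticAt`: for continuous positive `v`, `AnP v ↔` direction-wise real-analyticity at `0` of the limiting
  pressure — the existence clause of the certificate is automatic by `stub_torusPressureLimit`, p165456) and
  `Theorems/GronwallGapPathGapModulusTransitionsSingular.lean` (p165772, `pathGapModulus_iff_transitionsSingular`: the crux ⇔
  "for every admissible path, every TRANSITION parameter — a limit of clustering parameters that is not locally-uniformly
  clustering — is a limit of certificate-singular parameters"; no `AnP`-everywhere hypothesis survives, by restriction and affine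
  reparametrisation of admissible paths: the route thesis "the gap closes only at bulk pressure singularities", machine-checked
  equivalent to the filed decl). Wave 1 (S1, S2loc stub-workers, new angles only): both `stub-blocked` again — S1: the only
  tree region beyond the polydisc is the TV-Dobrushin Haar-neighbourhood `osc(log v) < 8.8e-3` reachable through
  `DobrushinMetric.abs_covariance_le_of_isKRContraction` (≈ 1–1.5 kloc to discharge; still a neighbourhood of `v ≡ const`, not
  S1), Chatterjee CMP 385 (2021) Def 2.3 corroborates UCw ⇏ b.c.-uniform decay; S2loc: kernel-checked no-go for any
  bookkeeping-only proof (`S2loc_shape_evidence.lean`), Regts PTRF 2023 (zero-free ⇒ SSM, finite spins) the one new reference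
  (memos `MEMO-c6-*.md`, crux dir). Fresh two-corpus presearch (2026-08-17): nothing usable for S1/S2loc/S3b. Logical status made
  explicit: since `crux ⇔ S1 ∧ S2loc ∧ S3b` and each factor is implied by the crux, EVERY line must prove all three;
  re-lining cannot evade them (LEAD-REPORT-c6.md).

* cycle 7 (lead c6): skeleton UNCHANGED in its stubs (re-registered, full signatures re-added). The one provable-now
  enlargement left open by cycle 6 is DISCHARGED and in the tree: Dobrushin uniqueness in the total-variation form for
  GENERAL continuous positive plaquette weights on tori — `Literature/MathematicalPhysics/QuantumFieldTheory/TorusPlaquetteNeighbours.lean`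
  (p172431: plaquette neighbours of a link, joint multiplicity `∑_y k(x,y) ≤ 6(d−1)`, periodic sup-distance),
  `…/PlaquetteWeightTorusSpecification.lean` (p172454: the torus weight specification, `IsSpecification`, one-link law =
  tilted Haar, `groupHeatKernelMeasure = (pi Haar).tilted`, DLR/Gibbs property), `Literature/Probability/LatticeModels/DobrushinTiltOscillation.lean`
  (p172462: `|μ^{h₁}(φ) − μ^{h₂}(φ)| ≤ ½(e^{2ε}−1) osc φ`), `…/PlaquetteWeightTorusDobrushin.lean` (p172966:
  `isKRContraction_torusWeightSpec` with `C e y = (k(e,y)/(4(d−1)))(e^{4(d−1)δ}−1)`, `δ = osc log v`, and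
  `plaquetteWeight_torusClustering_dobrushin` — volume-uniform exponential clustering whenever `(3/2)(e^{4(d−1)δ}−1) < 1`),
  and the Summits glue `Theorems/GronwallGapPathGapModulusDobrushinFloor.lean` (p173111: `plaquetteWeight_dobrushin_uniformClustering`,
  `pathGap_localFloor_dobrushin`, `pathGapModulus_of_dobrushinRegion`). The VERIFIED region of the crux is now
  `osc (log w s) < log(5/3)/12 ≈ 4.26·10⁻²` along the path (was the KP polydisc `sup|log w s| ≤ betaR 1 1296/4 ≈ 10^(−672.8)`):
  671 orders of magnitude, same qualitative (Haar-perturbative) status; S1/S2loc/S3b off that region remain the open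
  lattice conjectures of LEAD-REPORT-c6 (no new printed fact 2026-08-17).

`sorry` occurs ONLY in the three open `stub_*` theorems (S1 `stub_clusteringOpen`, S2loc `stub_localRateFloor`,
S3b `stub_uniformConstantsAtCommonRate`), all registered with full one-line signatures. Disproof used: none on file for
this crux (`ledger crux ls`, 2026-08-17T13:50Z: no `Disproof.lean`; no `Negative/` theorems; no crux ideas).
-/

set_option linter.unusedVariables false

namespace Summit.QuantumFields.YangMills.Cruxes.PathGapModulus.Birth

open scoped BigOperators Topology Manifold Classical MeasureTheory ProbabilityTheory Matrix InnerProductSpace ComplexConjugate ContinuousMap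
open Filter Set Function TopologicalSpace MeasureTheory

/-! ## The registered stubs (statements in full; the `let` preamble is the crux's, verbatim, restricted to what each stub uses) -/

/-- **Stub S1 — openness of clustering (`Γ_w` is relatively open in `[0,1]`).** For every compact simple `G` and every
admissible analytic-pressure weight path `w`: if the `w_(s₀)`-theory clusters volume-uniformly at some rate, then so
does the `w_s`-theory (at SOME rate, possibly depending on `s`) for every `s ∈ [0,1]` close enough to `s₀`.
Why plausibly true: perturbative stability of a massive RP lattice gauge theory under the extensive but
sup-norm-small perturbation `Σ_q (log w_s − log w_(s₀))(U_q)`, `‖·‖_∞ ≤ Λ|s−s₀|` per plaquette (cluster expansion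
around a clustering reference / spectral-flow stability of the transfer-matrix gap). Why it might fail: two-point
torus clustering with observable-dependent constants (no strong mixing, no complete analyticity, no LTQO) may be too
weak to be an open condition. Size: XL/open. Sources: doi:10.1007/bf01011153 (Dobrushin–Shlosman 1987),
BravyiHastingsMichalakis2010, OsterwalderSeilerAnnPhys1978, Kato1966 VII §3. [folklore] -/
theorem stub_clusteringOpen :
    ∀ (G : Type) [Group G] [TopologicalSpace G] [IsTopologicalGroup G] [CompactSpace G],
      Literature.MathematicalPhysics.QuantumFieldTheory.IsCompactSimpleLieGroup G →
      letI : MeasurableSpace G := borel G; haveI : BorelSpace G := ⟨rfl⟩;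
      let UCw : (ℝ → G → ℝ) → ℝ → ℝ → Prop := fun w s m => ∀ A B : Literature.MathematicalPhysics.QuantumFieldTheory.YMSpecies G, ∃ C : ℝ, ∃ S₀ : ℕ, ∀ S : ℕ, S₀ ≤ S → ∀ n : ℕ, n ≤ S → |(∫ U, A.F (Literature.MathematicalPhysics.QuantumLattice.torusLift (2 * S + 1) U) * B.F (Literature.MathematicalPhysics.QuantumLattice.configShift (-Pi.single 0 (n : ℤ)) (Literature.MathematicalPhysics.QuantumLattice.torusLift (2 * S + 1) U)) ∂(Literature.MathematicalPhysics.QuantumLattice.groupHeatKernelMeasure (d := 4) (L := 2 * S + 1) w s)) - (∫ U, A.F (Literature.MathematicalPhysics.QuantumLattice.torusLift (2 * S + 1) U) ∂(Literature.MathematicalPhysics.QuantumLattice.groupHeatKernelMeasure (d := 4) (L := 2 * S + 1) w s)) * (∫ U, B.F (Literature.MathematicalPhysics.QuantumLattice.torusLift (2 * S + 1) U) ∂(Literature.MathematicalPhysics.QuantumLattice.groupHeatKernelMeasure (d := 4) (L := 2 * S + 1) w s))| ≤ C * Real.exp (-(m * n));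
      let Pseq : (G → ℝ) → ℕ → ℝ := fun v L => (((L + 1 : ℕ) : ℝ) ^ 4)⁻¹ * Real.log (((MeasureTheory.Measure.pi fun _ : Literature.MathematicalPhysics.QuantumFieldTheory.Edge 4 (L + 1) => Literature.MathematicalPhysics.QuantumFieldTheory.haarProbability G).withDensity (fun U : Literature.MathematicalPhysics.QuantumFieldTheory.GaugeConfig 4 (L + 1) G => ENNReal.ofReal (Literature.MathematicalPhysics.QuantumLattice.groupHeatKernelWeight (fun _ : ℝ => v) 0 U))) Set.univ).toReal;
      let AnP : (G → ℝ) → Prop := fun v => ∀ φ : G → ℝ, Continuous φ → (∀ g h : G, φ (h * g * h⁻¹) = φ g) → ∃ p : ℝ → ℝ, (∀ t : ℝ, Filter.Tendsto (fun L : ℕ => Pseq (fun g => v g * Real.exp (t * φ g)) L) Filter.atTop (nhds (p t))) ∧ AnalyticAt ℝ p 0;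
      let Adm : (ℝ → G → ℝ) → Prop := fun w => (∀ s ∈ Set.Icc (0 : ℝ) 1, Continuous (w s) ∧ (∀ g : G, 0 < w s g) ∧ (∀ g h : G, w s (h * g * h⁻¹) = w s g) ∧ (∀ g : G, w s g⁻¹ = w s g) ∧ (∀ (n : ℕ) (x : Fin n → G) (c : Fin n → ℂ), 0 ≤ (∑ i, ∑ j, (starRingEnd ℂ) (c i) * c j * ((w s ((x i)⁻¹ * x j) : ℝ) : ℂ)).re)) ∧ ∃ Λ : ℝ, ∀ s ∈ Set.Icc (0 : ℝ) 1, ∀ s' ∈ Set.Icc (0 : ℝ) 1, ∀ g : G, |Real.log (w s g) - Real.log (w s' g)| ≤ Λ * |s - s'|;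
      ∀ w : ℝ → G → ℝ, Adm w → (∀ s ∈ Set.Icc (0 : ℝ) 1, AnP (w s)) →
        ∀ s₀ ∈ Set.Icc (0 : ℝ) 1, (∃ m₀ : ℝ, 0 < m₀ ∧ UCw w s₀ m₀) → ∃ ε : ℝ, 0 < ε ∧ ∀ s ∈ Set.Icc (0 : ℝ) 1, |s - s₀| < ε → ∃ m : ℝ, 0 < m ∧ UCw w s m := by
  sorry

/-- **Stub S2loc — local rate floor (no critical slowing down NEAR a parameter; the local form of S2).** For every
compact simple `G`, every admissible analytic-pressure weight path `w` and every `s₀ ∈ [0,1]` there are `ε, μ > 0`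
such that every parameter `s ∈ [0,1]` with `|s − s₀| < ε` whose theory clusters volume-uniformly at some rate
clusters at rate `μ`. Equivalent to the cycle-3 stub S2 `stub_uniformRate` by compactness of `[0,1]`
(`uniformRate_of_localRateFloor` below; the converse is trivial), and the shape in which any perturbative / RG
argument around `s₀` would deliver it. Why plausibly true: a rate degenerating along clustering parameters
`s_k → s*` is a diverging correlation length, i.e. a continuous bulk transition at `s*`, whose torus pressure should
be singular in some single-plaquette class-function direction (hyperscaling), contradicting `AnP` at `s*`. Why it
might fail: an excited level may descend onto the vacuum with no thermodynamic trace (pointwise real analyticity of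
the limiting pressure does not bound finite-volume susceptibilities: counter-model in CERTIFICATE-ANALYSIS-c3.md).
Size: XL/open. Sources: doi:10.1007/bf01011153, doi:10.1007/bf01609445, arXiv:hep-lat/0103027 §3. [folklore] -/
theorem stub_localRateFloor :
    ∀ (G : Type) [Group G] [TopologicalSpace G] [IsTopologicalGroup G] [CompactSpace G],
      Literature.MathematicalPhysics.QuantumFieldTheory.IsCompactSimpleLieGroup G →
      letI : MeasurableSpace G := borel G; haveI : BorelSpace G := ⟨rfl⟩;
      let UCw : (ℝ → G → ℝ) → ℝ → ℝ → Prop := fun w s m => ∀ A B : Literature.MathematicalPhysics.QuantumFieldTheory.YMSpecies G, ∃ C : ℝ, ∃ S₀ : ℕ, ∀ S : ℕ, S₀ ≤ S → ∀ n : ℕ, n ≤ S → |(∫ U, A.F (Literature.MathematicalPhysics.QuantumLattice.torusLift (2 * S + 1) U) * B.F (Literature.MathematicalPhysics.QuantumLattice.configShift (-Pi.single 0 (n : ℤ)) (Literature.MathematicalPhysics.QuantumLattice.torusLift (2 * S + 1) U)) ∂(Literature.MathematicalPhysics.QuantumLattice.groupHeatKernelMeasure (d := 4) (L := 2 * S +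 1) w s)) - (∫ U, A.F (Literature.MathematicalPhysics.QuantumLattice.torusLift (2 * S + 1) U) ∂(Literature.MathematicalPhysics.QuantumLattice.groupHeatKernelMeasure (d := 4) (L := 2 * S + 1) w s)) * (∫ U, B.F (Literature.MathematicalPhysics.QuantumLattice.torusLift (2 * S + 1) U) ∂(Literature.MathematicalPhysics.QuantumLattice.groupHeatKernelMeasure (d := 4) (L := 2 * S + 1) w s))| ≤ C * Real.exp (-(m * n));
      let Pseq : (G → ℝ) → ℕ → ℝ := fun v L => (((L + 1 : ℕ) : ℝ) ^ 4)⁻¹ * Real.log (((MeasureTheory.Measure.pi fun _ : Literature.MathematicalPhysics.QuantumFieldTheory.Edge 4 (L + 1) => Literature.MathematicalPhysics.QuantumFieldTheory.haarProbability G).withDensity (fun U : Literature.MathematicalPhysics.QuantumFieldTheory.GaugeConfig 4 (L + 1) G => ENNReal.ofReal (Literature.MathematicalPhysics.QuantumLattice.groupHeatKernelWeight (fun _ : ℝ => v) 0 U))) Set.univ).toReal;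
      let AnP : (G → ℝ) → Prop := fun v => ∀ φ : G → ℝ, Continuous φ → (∀ g h : G, φ (h * g * h⁻¹) = φ g) → ∃ p : ℝ → ℝ, (∀ t : ℝ, Filter.Tendsto (fun L : ℕ => Pseq (fun g => v g * Real.exp (t * φ g)) L) Filter.atTop (nhds (p t))) ∧ AnalyticAt ℝ p 0;
      let Adm : (ℝ → G → ℝ) → Prop := fun w => (∀ s ∈ Set.Icc (0 : ℝ) 1, Continuous (w s) ∧ (∀ g : G, 0 < w s g) ∧ (∀ g h : G, w s (h * g * h⁻¹) = w s g) ∧ (∀ g : G, w s g⁻¹ = w s g) ∧ (∀ (n : ℕ) (x : Fin n → G) (c : Fin n → ℂ), 0 ≤ (∑ i, ∑ j, (starRingEnd ℂ) (c i) * c j * ((w s ((x i)⁻¹ * x j) : ℝ) : ℂ)).re)) ∧ ∃ Λ : ℝ, ∀ s ∈ Set.Icc (0 : ℝ) 1, ∀ s' ∈ Set.Icc (0 : ℝ) 1, ∀ g : G, |Real.log (w s g) - Real.log (w s' g)| ≤ Λ * |s - s'|;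
      ∀ w : ℝ → G → ℝ, Adm w → (∀ s ∈ Set.Icc (0 : ℝ) 1, AnP (w s)) →
        ∀ s₀ ∈ Set.Icc (0 : ℝ) 1, ∃ ε μ : ℝ, 0 < ε ∧ 0 < μ ∧
          ∀ s ∈ Set.Icc (0 : ℝ) 1, |s - s₀| < ε → (∃ m : ℝ, 0 < m ∧ UCw w s m) → UCw w s μ := by
  sorry

/-- **Stub S3b — common rate forces common constants (the OPEN physics core of S3, isolated).** For every compact
simple `G` and every admissible analytic-pressure weight path `w` along which every continuous class-function one-point
function has continuous infinite-volume limits (the conclusion of `stub_onePointContinuous`, kept as an explicit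
hypothesis next to `AnP` so that the stub records the intended mechanism; the crux implies this stub, see
`pathGapModulus_iff_localTrichotomy`): if `s₀ ∈ [0,1]` is approximated by
parameters whose theories cluster volume-uniformly at one COMMON rate `μ`, then at some rate `μ' > 0` they do so with
observable-wise common constants (the hypothesis shape of `stub_closedOfUniformConstants`). Why plausibly true: blow-up
of `S₀(A,B)`/`C(A,B)` at a fixed rate along `s_k → s₀` is the finite-size signature of a first-order point at `s₀`
(metastable phase of weight `e^(−L⁴Δf_k)`, `Δf_k → 0`), and coexisting phases generically differ in some one-plaquette
class-function expectation, contradicting one-point continuity. Why it might fail: coexistence invisible to all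
single-plaquette one-point functions (phases related by a spontaneously broken lattice/charge-conjugation symmetry).
Size: XL/open. Sources: doi:10.1007/bf01011153, Israel1979, arXiv:hep-lat/0103027 §3. [folklore] -/
theorem stub_uniformConstantsAtCommonRate :
    ∀ (G : Type) [Group G] [TopologicalSpace G] [IsTopologicalGroup G] [CompactSpace G],
      Literature.MathematicalPhysics.QuantumFieldTheory.IsCompactSimpleLieGroup G →
      letI : MeasurableSpace G := borel G; haveI : BorelSpace G := ⟨rfl⟩;
      let UCw : (ℝ → G → ℝ) → ℝ → ℝ → Prop := fun w s m => ∀ A B : Literature.MathematicalPhysics.QuantumFieldTheory.YMSpecies G, ∃ C : ℝ, ∃ S₀ : ℕ, ∀ S : ℕ, S₀ ≤ S → ∀ n : ℕ, n ≤ S → |(∫ U, A.F (Literature.MathematicalPhysics.QuantumLattice.torusLift (2 * S + 1) U) * B.F (Literature.MathematicalPhysics.QuantumLattice.configShift (-Pi.single 0 (n : ℤ)) (Literature.MathematicalPhysics.QuantumLattice.torusLift (2 * S + 1) U)) ∂(Literature.MathematicalPhysics.QuantumLattice.groupHeatKernelMeasure (d := 4) (L := 2 * S + 1) w s)) - (∫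 U, A.F (Literature.MathematicalPhysics.QuantumLattice.torusLift (2 * S + 1) U) ∂(Literature.MathematicalPhysics.QuantumLattice.groupHeatKernelMeasure (d := 4) (L := 2 * S + 1) w s)) * (∫ U, B.F (Literature.MathematicalPhysics.QuantumLattice.torusLift (2 * S + 1) U) ∂(Literature.MathematicalPhysics.QuantumLattice.groupHeatKernelMeasure (d := 4) (L := 2 * S + 1) w s))| ≤ C * Real.exp (-(m * n));
      let Pseq : (G → ℝ) → ℕ → ℝ := fun v L => (((L + 1 : ℕ) : ℝ) ^ 4)⁻¹ * Real.log (((MeasureTheory.Measure.pi fun _ : Literature.MathematicalPhysics.QuantumFieldTheory.Edge 4 (L + 1) => Literature.MathematicalPhysics.QuantumFieldTheory.haarProbability G).withDensity (fun U : Literature.MathematicalPhysics.QuantumFieldTheory.GaugeConfig 4 (L + 1) G => ENNReal.ofReal (Literature.MathematicalPhysics.QuantumLattice.groupHeatKernelWeight (fun _ : ℝ => v) 0 U))) Set.univ).toReal;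
      let AnP : (G → ℝ) → Prop := fun v => ∀ φ : G → ℝ, Continuous φ → (∀ g h : G, φ (h * g * h⁻¹) = φ g) → ∃ p : ℝ → ℝ, (∀ t : ℝ, Filter.Tendsto (fun L : ℕ => Pseq (fun g => v g * Real.exp (t * φ g)) L) Filter.atTop (nhds (p t))) ∧ AnalyticAt ℝ p 0;
      let Adm : (ℝ → G → ℝ) → Prop := fun w => (∀ s ∈ Set.Icc (0 : ℝ) 1, Continuous (w s) ∧ (∀ g : G, 0 < w s g) ∧ (∀ g h : G, w s (h * g * h⁻¹) = w s g) ∧ (∀ g : G, w s g⁻¹ = w s g) ∧ (∀ (n : ℕ) (x : Fin n → G) (c : Fin n → ℂ), 0 ≤ (∑ i, ∑ j, (starRingEnd ℂ) (c i) * c j * ((w s ((x i)⁻¹ * x j) : ℝ) : ℂ)).re)) ∧ ∃ Λ : ℝ, ∀ s ∈ Set.Icc (0 : ℝ) 1, ∀ s' ∈ Set.Icc (0 : ℝ) 1, ∀ g : G, |Real.log (w s g) - Real.log (w s' g)| ≤ Λ * |s - s'|;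
      ∀ w : ℝ → G → ℝ, Adm w → (∀ s ∈ Set.Icc (0 : ℝ) 1, AnP (w s)) →
        (∀ φ : G → ℝ, Continuous φ → (∀ g h : G, φ (h * g * h⁻¹) = φ g) → ∃ a : ℝ → ℝ, ContinuousOn a (Set.Icc 0 1) ∧ ∀ s ∈ Set.Icc (0 : ℝ) 1, Filter.Tendsto (fun L => (Fintype.card (Literature.MathematicalPhysics.QuantumFieldTheory.Plaquette 4 (L + 1)) : ℝ)⁻¹ * ∑ q : Literature.MathematicalPhysics.QuantumFieldTheory.Plaquette 4 (L + 1), ∫ U, φ (Literature.MathematicalPhysics.QuantumFieldTheory.plaquetteHolonomy U q.1 q.2.1.1 q.2.1.2) ∂(Literature.MathematicalPhysics.QuantumLattice.groupHeatKernelMeasure (d := 4) (L := L + 1) w s)) Filter.atTop (nhds (a s))) →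
        ∀ s₀ ∈ Set.Icc (0 : ℝ) 1, ∀ μ : ℝ, 0 < μ → (∀ ε : ℝ, 0 < ε → ∃ s ∈ Set.Icc (0 : ℝ) 1, |s - s₀| < ε ∧ UCw w s μ) →
          ∃ ν : ℝ, 0 < ν ∧ ∀ A B : Literature.MathematicalPhysics.QuantumFieldTheory.YMSpecies G, ∃ C : ℝ, ∃ S₀ : ℕ, ∀ ε : ℝ, 0 < ε → ∃ s ∈ Set.Icc (0 : ℝ) 1, |s - s₀| < ε ∧ ∀ S : ℕ, S₀ ≤ S → ∀ n : ℕ, n ≤ S → |(∫ U, A.F (Literature.MathematicalPhysics.QuantumLattice.torusLift (2 * S + 1) U) * B.F (Literature.MathematicalPhysics.QuantumLattice.configShift (-Pi.single 0 (n : ℤ)) (Literature.MathematicalPhysics.QuantumLattice.torusLift (2 * S + 1) U)) ∂(Literature.MathematicalPhysics.QuantumLattice.groupHeatKernelMeasure (d := 4) (L := 2 * S + 1) w s)) - (∫ U, A.F (Literature.MathematicalPhysics.QuantumLattice.torusLift (2 * S + 1) U) ∂(Literature.MathematicalPhysics.QuantumLattice.groupHeatKernelMeasure (d := 4) (L :=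 2 * S + 1) w s)) * (∫ U, B.F (Literature.MathematicalPhysics.QuantumLattice.torusLift (2 * S + 1) U) ∂(Literature.MathematicalPhysics.QuantumLattice.groupHeatKernelMeasure (d := 4) (L := 2 * S + 1) w s))| ≤ C * Real.exp (-(ν * n)) := by
  sorry

/-! ## Composition (in the tree) -/

/-- **The crux from S1, S2loc, S3b** — the landed tree composition
`Summit.QuantumFields.YangMills.Theorems.pathGapModulus_of_localTrichotomy` (p161847), whose three hypotheses are the
statements of the registered stubs verbatim and in this order; the cut is lossless
(`Summit.QuantumFields.YangMills.Theorems.pathGapModulus_iff_localTrichotomy`: each stub is implied by the crux, so a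
`stub-false` on any of them refutes the crux itself). [folklore] -/
theorem PathGapModulus_of :
    (∀ (G : Type) [Group G] [TopologicalSpace G] [IsTopologicalGroup G] [CompactSpace G],
      Literature.MathematicalPhysics.QuantumFieldTheory.IsCompactSimpleLieGroup G →
      letI : MeasurableSpace G := borel G; haveI : BorelSpace G := ⟨rfl⟩;
      let UCw : (ℝ → G → ℝ) → ℝ → ℝ → Prop := fun w s m => ∀ A B : Literature.MathematicalPhysics.QuantumFieldTheory.YMSpecies G, ∃ C : ℝ, ∃ S₀ : ℕ, ∀ S : ℕ, S₀ ≤ S → ∀ n : ℕ, n ≤ S → |(∫ U, A.F (Literature.MathematicalPhysics.QuantumLattice.torusLift (2 * S + 1) U) * B.F (Literature.MathematicalPhysics.QuantumLattice.configShift (-Pi.single 0 (n : ℤ)) (Literature.MathematicalPhysics.QuantumLattice.torusLift (2 * S + 1) U)) ∂(Literature.MathematicalPhysics.QuantumLattice.groupHeatKernelMeasure (d := 4) (L := 2 * S + 1) w s)) - (∫ U, A.F (Literature.MathematicalPhysics.QuantumLattice.torusLift (2 * S + 1) U) ∂(Literature.MathematicalPhysics.QuantumLattice.groupHeatKernelMeasure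 (d := 4) (L := 2 * S + 1) w s)) * (∫ U, B.F (Literature.MathematicalPhysics.QuantumLattice.torusLift (2 * S + 1) U) ∂(Literature.MathematicalPhysics.QuantumLattice.groupHeatKernelMeasure (d := 4) (L := 2 * S + 1) w s))| ≤ C * Real.exp (-(m * n));
      let Pseq : (G → ℝ) → ℕ → ℝ := fun v L => (((L + 1 : ℕ) : ℝ) ^ 4)⁻¹ * Real.log (((MeasureTheory.Measure.pi fun _ : Literature.MathematicalPhysics.QuantumFieldTheory.Edge 4 (L + 1) => Literature.MathematicalPhysics.QuantumFieldTheory.haarProbability G).withDensity (fun U : Literature.MathematicalPhysics.QuantumFieldTheory.GaugeConfig 4 (L + 1) G => ENNReal.ofReal (Literature.MathematicalPhysics.QuantumLattice.groupHeatKernelWeight (fun _ : ℝ => v) 0 U))) Set.univ).toReal;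
      let AnP : (G → ℝ) → Prop := fun v => ∀ φ : G → ℝ, Continuous φ → (∀ g h : G, φ (h * g * h⁻¹) = φ g) → ∃ p : ℝ → ℝ, (∀ t : ℝ, Filter.Tendsto (fun L : ℕ => Pseq (fun g => v g * Real.exp (t * φ g)) L) Filter.atTop (nhds (p t))) ∧ AnalyticAt ℝ p 0;
      let Adm : (ℝ → G → ℝ) → Prop := fun w => (∀ s ∈ Set.Icc (0 : ℝ) 1, Continuous (w s) ∧ (∀ g : G, 0 < w s g) ∧ (∀ g h : G, w s (h * g * h⁻¹) = w s g) ∧ (∀ g : G, w s g⁻¹ = w s g) ∧ (∀ (n : ℕ) (x : Fin n → G) (c : Fin n → ℂ), 0 ≤ (∑ i, ∑ j, (starRingEnd ℂ) (c i) * c j * ((w s ((x i)⁻¹ * x j) : ℝ) : ℂ)).re)) ∧ ∃ Λ : ℝ, ∀ s ∈ Set.Icc (0 : ℝ) 1, ∀ s' ∈ Set.Icc (0 : ℝ) 1, ∀ g : G, |Real.log (w s g) - Real.log (w s' g)| ≤ Λ * |s - s'|;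
      ∀ w : ℝ → G → ℝ, Adm w → (∀ s ∈ Set.Icc (0 : ℝ) 1, AnP (w s)) →
        ∀ s₀ ∈ Set.Icc (0 : ℝ) 1, (∃ m₀ : ℝ, 0 < m₀ ∧ UCw w s₀ m₀) → ∃ ε : ℝ, 0 < ε ∧ ∀ s ∈ Set.Icc (0 : ℝ) 1, |s - s₀| < ε → ∃ m : ℝ, 0 < m ∧ UCw w s m) →
    (∀ (G : Type) [Group G] [TopologicalSpace G] [IsTopologicalGroup G] [CompactSpace G],
      Literature.MathematicalPhysics.QuantumFieldTheory.IsCompactSimpleLieGroup G →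
      letI : MeasurableSpace G := borel G; haveI : BorelSpace G := ⟨rfl⟩;
      let UCw : (ℝ → G → ℝ) → ℝ → ℝ → Prop := fun w s m => ∀ A B : Literature.MathematicalPhysics.QuantumFieldTheory.YMSpecies G, ∃ C : ℝ, ∃ S₀ : ℕ, ∀ S : ℕ, S₀ ≤ S → ∀ n : ℕ, n ≤ S → |(∫ U, A.F (Literature.MathematicalPhysics.QuantumLattice.torusLift (2 * S + 1) U) * B.F (Literature.MathematicalPhysics.QuantumLattice.configShift (-Pi.single 0 (n : ℤ)) (Literature.MathematicalPhysics.QuantumLattice.torusLift (2 * S + 1) U)) ∂(Literature.MathematicalPhysics.QuantumLattice.groupHeatKernelMeasure (d := 4) (L := 2 * S + 1) w s)) - (∫ U, A.F (Literature.MathematicalPhysics.QuantumLattice.torusLift (2 * S + 1) U) ∂(Literature.MathematicalPhysics.QuantumLattice.groupHeatKernelMeasure (d := 4) (L := 2 * S + 1) w s)) * (∫ U, B.F (Literature.MathematicalPhysics.QuantumLattice.torusLift (2 * S + 1) U) ∂(Literature.MathematicalPhysics.QuantumLattice.groupHeatKernelMeasure (d := 4) (L := 2 * S + 1) w s))| ≤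 C * Real.exp (-(m * n));
      let Pseq : (G → ℝ) → ℕ → ℝ := fun v L => (((L + 1 : ℕ) : ℝ) ^ 4)⁻¹ * Real.log (((MeasureTheory.Measure.pi fun _ : Literature.MathematicalPhysics.QuantumFieldTheory.Edge 4 (L + 1) => Literature.MathematicalPhysics.QuantumFieldTheory.haarProbability G).withDensity (fun U : Literature.MathematicalPhysics.QuantumFieldTheory.GaugeConfig 4 (L + 1) G => ENNReal.ofReal (Literature.MathematicalPhysics.QuantumLattice.groupHeatKernelWeight (fun _ : ℝ => v) 0 U))) Set.univ).toReal;
      let AnP : (G → ℝ) → Prop := fun v => ∀ φ : G → ℝ, Continuous φ → (∀ g h : G, φ (h * g * h⁻¹) = φ g) → ∃ p : ℝ → ℝ, (∀ t : ℝ, Filter.Tendsto (fun L : ℕ => Pseq (fun g => v g * Real.exp (t * φ g)) L) Filter.atTop (nhds (p t))) ∧ AnalyticAt ℝ p 0;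
      let Adm : (ℝ → G → ℝ) → Prop := fun w => (∀ s ∈ Set.Icc (0 : ℝ) 1, Continuous (w s) ∧ (∀ g : G, 0 < w s g) ∧ (∀ g h : G, w s (h * g * h⁻¹) = w s g) ∧ (∀ g : G, w s g⁻¹ = w s g) ∧ (∀ (n : ℕ) (x : Fin n → G) (c : Fin n → ℂ), 0 ≤ (∑ i, ∑ j, (starRingEnd ℂ) (c i) * c j * ((w s ((x i)⁻¹ * x j) : ℝ) : ℂ)).re)) ∧ ∃ Λ : ℝ, ∀ s ∈ Set.Icc (0 : ℝ) 1, ∀ s' ∈ Set.Icc (0 : ℝ) 1, ∀ g : G, |Real.log (w s g) - Real.log (w s' g)| ≤ Λ * |s - s'|;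
      ∀ w : ℝ → G → ℝ, Adm w → (∀ s ∈ Set.Icc (0 : ℝ) 1, AnP (w s)) →
        ∀ s₀ ∈ Set.Icc (0 : ℝ) 1, ∃ ε μ : ℝ, 0 < ε ∧ 0 < μ ∧
          ∀ s ∈ Set.Icc (0 : ℝ) 1, |s - s₀| < ε → (∃ m : ℝ, 0 < m ∧ UCw w s m) → UCw w s μ) →
    (∀ (G : Type) [Group G] [TopologicalSpace G] [IsTopologicalGroup G] [CompactSpace G],
      Literature.MathematicalPhysics.QuantumFieldTheory.IsCompactSimpleLieGroup G →
      letI : MeasurableSpace G := borel G; haveI : BorelSpace G := ⟨rfl⟩;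
      let UCw : (ℝ → G → ℝ) → ℝ → ℝ → Prop := fun w s m => ∀ A B : Literature.MathematicalPhysics.QuantumFieldTheory.YMSpecies G, ∃ C : ℝ, ∃ S₀ : ℕ, ∀ S : ℕ, S₀ ≤ S → ∀ n : ℕ, n ≤ S → |(∫ U, A.F (Literature.MathematicalPhysics.QuantumLattice.torusLift (2 * S + 1) U) * B.F (Literature.MathematicalPhysics.QuantumLattice.configShift (-Pi.single 0 (n : ℤ)) (Literature.MathematicalPhysics.QuantumLattice.torusLift (2 * S + 1) U)) ∂(Literature.MathematicalPhysics.QuantumLattice.groupHeatKernelMeasure (d := 4) (L := 2 * S + 1) w s)) - (∫ U, A.F (Literature.MathematicalPhysics.QuantumLattice.torusLift (2 * S + 1) U) ∂(Literature.MathematicalPhysics.QuantumLattice.groupHeatKernelMeasure (d := 4) (L := 2 * S + 1) w s)) * (∫ U, B.F (Literature.MathematicalPhysics.QuantumLattice.torusLift (2 * S + 1) U) ∂(Literature.MathematicalPhysics.QuantumLattice.groupHeatKernelMeasure (d := 4) (L := 2 * S + 1) w s))| ≤ C * Real.exp (-(m * n));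
      let Pseq : (G → ℝ) → ℕ → ℝ := fun v L => (((L + 1 : ℕ) : ℝ) ^ 4)⁻¹ * Real.log (((MeasureTheory.Measure.pi fun _ : Literature.MathematicalPhysics.QuantumFieldTheory.Edge 4 (L + 1) => Literature.MathematicalPhysics.QuantumFieldTheory.haarProbability G).withDensity (fun U : Literature.MathematicalPhysics.QuantumFieldTheory.GaugeConfig 4 (L + 1) G => ENNReal.ofReal (Literature.MathematicalPhysics.QuantumLattice.groupHeatKernelWeight (fun _ : ℝ => v) 0 U))) Set.univ).toReal;
      let AnP : (G → ℝ) → Prop := fun v => ∀ φ : G → ℝ, Continuous φ → (∀ g h : G, φ (h * g * h⁻¹) = φ g) → ∃ p : ℝ → ℝ, (∀ t : ℝ, Filter.Tendsto (fun L : ℕ => Pseq (fun g => v g * Real.exp (t * φ g)) L) Filter.atTop (nhds (p t))) ∧ AnalyticAt ℝ p 0;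
      let Adm : (ℝ → G → ℝ) → Prop := fun w => (∀ s ∈ Set.Icc (0 : ℝ) 1, Continuous (w s) ∧ (∀ g : G, 0 < w s g) ∧ (∀ g h : G, w s (h * g * h⁻¹) = w s g) ∧ (∀ g : G, w s g⁻¹ = w s g) ∧ (∀ (n : ℕ) (x : Fin n → G) (c : Fin n → ℂ), 0 ≤ (∑ i, ∑ j, (starRingEnd ℂ) (c i) * c j * ((w s ((x i)⁻¹ * x j) : ℝ) : ℂ)).re)) ∧ ∃ Λ : ℝ, ∀ s ∈ Set.Icc (0 : ℝ) 1, ∀ s' ∈ Set.Icc (0 : ℝ) 1, ∀ g : G, |Real.log (w s g) - Real.log (w s' g)| ≤ Λ * |s - s'|;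
      ∀ w : ℝ → G → ℝ, Adm w → (∀ s ∈ Set.Icc (0 : ℝ) 1, AnP (w s)) →
        (∀ φ : G → ℝ, Continuous φ → (∀ g h : G, φ (h * g * h⁻¹) = φ g) → ∃ a : ℝ → ℝ, ContinuousOn a (Set.Icc 0 1) ∧ ∀ s ∈ Set.Icc (0 : ℝ) 1, Filter.Tendsto (fun L => (Fintype.card (Literature.MathematicalPhysics.QuantumFieldTheory.Plaquette 4 (L + 1)) : ℝ)⁻¹ * ∑ q : Literature.MathematicalPhysics.QuantumFieldTheory.Plaquette 4 (L + 1), ∫ U, φ (Literature.MathematicalPhysics.QuantumFieldTheory.plaquetteHolonomy U q.1 q.2.1.1 q.2.1.2) ∂(Literature.MathematicalPhysics.QuantumLattice.groupHeatKernelMeasure (d := 4) (L := L + 1) w s)) Filter.atTop (nhds (a s))) →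
        ∀ s₀ ∈ Set.Icc (0 : ℝ) 1, ∀ μ : ℝ, 0 < μ → (∀ ε : ℝ, 0 < ε → ∃ s ∈ Set.Icc (0 : ℝ) 1, |s - s₀| < ε ∧ UCw w s μ) →
          ∃ ν : ℝ, 0 < ν ∧ (∀ A B : Literature.MathematicalPhysics.QuantumFieldTheory.YMSpecies G, ∃ C : ℝ, ∃ S₀ : ℕ, ∀ ε : ℝ, 0 < ε → ∃ s ∈ Set.Icc (0 : ℝ) 1, |s - s₀| < ε ∧ ∀ S : ℕ, S₀ ≤ S → ∀ n : ℕ, n ≤ S → |(∫ U, A.F (Literature.MathematicalPhysics.QuantumLattice.torusLift (2 * S + 1) U) * B.F (Literature.MathematicalPhysics.QuantumLattice.configShift (-Pi.single 0 (n : ℤ)) (Literature.MathematicalPhysics.QuantumLattice.torusLift (2 * S + 1) U)) ∂(Literature.MathematicalPhysics.QuantumLattice.groupHeatKernelMeasure (d := 4) (L := 2 * S + 1) w s)) - (∫ U, A.F (Literature.MathematicalPhysics.QuantumLattice.torusLift (2 * S + 1) U) ∂(Literature.MathematicalPhysics.QuantumLattice.groupHeatKernelMeasure (d := 4) (L :=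 2 * S + 1) w s)) * (∫ U, B.F (Literature.MathematicalPhysics.QuantumLattice.torusLift (2 * S + 1) U) ∂(Literature.MathematicalPhysics.QuantumLattice.groupHeatKernelMeasure (d := 4) (L := 2 * S + 1) w s))| ≤ C * Real.exp (-(ν * n)))) →
    Summit.QuantumFields.YangMills.Theses.GronwallGap.PathGapModulus :=
  Summit.QuantumFields.YangMills.Theorems.pathGapModulus_of_localTrichotomy

/-- **THE skeleton instantiated**: the crux BY NAME from the three declared (sorried) local stubs via the tree
composition; type-checking this line certifies that the stub statements are exactly the composition's hypotheses. [folklore] -/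
theorem PathGapModulus_skeleton : Summit.QuantumFields.YangMills.Theses.GronwallGap.PathGapModulus :=
  PathGapModulus_of stub_clusteringOpen stub_localRateFloor stub_uniformConstantsAtCommonRate

end Summit.QuantumFields.YangMills.Cruxes.PathGapModulus.Birth
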